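import Literature.Barriers.CriticalPhenomena.LaceExpansionIsingAboveFourNarrowProofs
import Literature.Probability.LatticeModels.CriticalTwoPointDCPLower
import Literature.Probability.LatticeModels.TwoPointGradientEstimate
import Literature.Probability.LatticeModels.PlanarIsingCriticalMagnetization
import HarnessLib

/-!
# Duminil-Copin–Panis 2025, Theorem 1.3 at `β_c` from Theorem 1.2 at `β_c`

Topic `Literature/Probability/LatticeModels`; family `crit-ising`. Theorem-only companion of
`CriticalTwoPointDCPLower.lean`, which vendors, as named facts at `β = β_c`, Duminil-Copin–Panis,
*New lower bounds for the (near) critical Ising and φ⁴ models' two-point functions*, CMP 406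
(2025) = arXiv:2404.05700, **Theorem 1.2** (`dcp_reflectedGradient_lower`, the reflected-current
inequality `∑_{x,y ∈ Λ_n, y∼x} (⟨σ₀σ_x⟩ - ⟨σ₀σ_{𝓡_n x}⟩)⟨σ_yσ_{𝓡_n y}⟩ ≥ c₀`) and **Theorem 1.3**
(`dcp_criticalTwoPoint_axis_lower`, the axial lower bound
`⟨σ₀σ_{ne₁}⟩_{β_c} ≥ c₁ / (χ_{4n}(β_c) + n^{d-2} ∑_{1 ≤ k ≤ 2n} k⟨σ₀σ_{ke₁}⟩_{β_c})`).

Here the second is PROVED from the first (`dcp_criticalTwoPoint_axis_lower_of_reflectedGradient`),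
following the printed proof of Theorem 1.3 (p. 5): split the sum of Theorem 1.2 (at `4n`)
according to `x₁ ≤ 2n` or `x₁ > 2n`; the first half is at most `χ_{4n} ⟨σ₀σ_{ne₁}⟩` up to `2d`
(Messager–Miracle-Solé), the second at most `C n^{d-2} ⟨σ₀σ_{ne₁}⟩ ∑_{k ≤ 4n} k ⟨σ₀σ_{ke₁}⟩` by the
gradient estimate (1.11) (the tree's `twoPointFree_criticalBeta_gradient_estimate`,
`TwoPointGradientEstimate.lean`) and Messager–Miracle-Solé. The two summed halves are the
lemmas `DCPBubble.firstHalf_le`, `DCPBubble.secondHalf_le`, `DCPBubble.tsum_shift_le` of the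
barrier-catalogue proof file `LaceExpansionIsingAboveFourNarrowProofs.lean` (imported for them;
no import cycle: that file does not depend on this one), written there for the proof of
Theorem 1.8; the only additional steps are (i) matching the fact's rendering of the sum of
Theorem 1.2 (`dcpReflect`, `⟨σ_yσ_{𝓡 y}⟩`) with the proof file's (`axisRefl`, `⟨σ₀σ_{y-𝓡 y}⟩`), by
translation invariance and evenness of the free state; (ii) shortening the axis sum from
`k ≤ 4n` to `k ≤ 2n` (`∑_{2n<k≤4n} k⟨σ₀σ_{ke₁}⟩ ≤ 8n²⟨σ₀σ_{2ne₁}⟩ ≤ 8∑_{n<k≤2n} k⟨σ₀σ_{ke₁}⟩`,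
Messager–Miracle-Solé); (iii) absorbing an additive `1` with `⟨σ₀σ_{e₁}⟩_{β_c} > 0` (Simon's
lower bound, `criticalTwoPoint_bounds_holds`). Consequently the DCP cluster at `β_c` — Theorems
1.3, 1.5 (`CriticalEtaUpperDCP.lean`), 1.8 (`IsingBubbleDivergence.lean`, via
`Literature.Barriers.CriticalPhenomena.LaceExpansionIsingAboveFourNarrowAssembly`) — rests on
Theorem 1.2 alone. No definition, no named fact (D-0026).

## References

* H. Duminil-Copin, R. Panis, CMP 406 (2025), arXiv:2404.05700, Theorems 1.2, 1.3 and the proof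
  of Theorem 1.3 (eqs. (1.10)–(1.13)) [DuminilCopinPanis2025LowerBounds].
* A. Messager, S. Miracle-Solé, J. Stat. Phys. 17 (1977) 245 [MessagerMiracleSoleJSP1977].
-/

noncomputable section

open Finset
open Literature.Probability.Percolation
open Literature.Barriers.CriticalPhenomena.DCPBubble
open scoped BigOperators

namespace Literature.Probability.LatticeModels

variable {d : ℕ}

/-! ### Elementary rearrangements of the axis sum -/

/-- Shortening the weighted axis sum with a nonincreasing profile: if `0 ≤ g`, `g (k+1) ≤ g k`,
then `∑_{s ≤ 4n} s g(s) ≤ 9 ∑_{1 ≤ k ≤ 2n} k g(k)` (the tail `2n < s ≤ 4n` is at most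
`8n² g(2n) ≤ 8 ∑_{n < k ≤ 2n} k g(k)`). [folklore] -/
theorem sum_range_mul_le_nine_mul_sum_Icc {g : ℕ → ℝ} (hg0 : ∀ k, 0 ≤ g k)
    (hmono : ∀ k, g (k + 1) ≤ g k) (n : ℕ) :
    ∑ s ∈ range (4 * n + 1), (s : ℝ) * g s ≤ 9 * ∑ k ∈ Icc 1 (2 * n), (k : ℝ) * g k := by
  have hanti : ∀ {a b : ℕ}, a ≤ b → g b ≤ g a := by
    intro a b hab
    induction hab with
    | refl => exact le_rfl
    | step _ ih => exact (hmono _).trans ih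
  have hW0 : 0 ≤ ∑ k ∈ Icc 1 (2 * n), (k : ℝ) * g k :=
    sum_nonneg fun k _ => mul_nonneg (Nat.cast_nonneg k) (hg0 k)
  -- split the range at `2n + 1`
  have hsplit : ∑ s ∈ range (4 * n + 1), (s : ℝ) * g s =
      ∑ s ∈ range (2 * n + 1), (s : ℝ) * g s + ∑ s ∈ Ico (2 * n + 1) (4 * n + 1), (s : ℝ) * g s := by
    rw [range_eq_Ico, range_eq_Ico]
    exact (sum_Ico_consecutive _ (by omega) (by omega)).symm
  -- the head is the `Icc` sum (the `s = 0` term vanishes)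
  have hhead : ∑ s ∈ range (2 * n + 1), (s : ℝ) * g s = ∑ k ∈ Icc 1 (2 * n), (k : ℝ) * g k := by
    rw [range_eq_Ico, sum_eq_sum_Ico_succ_bot (by omega : 0 < 2 * n + 1), Nat.cast_zero, zero_mul,
      zero_add]
    rfl
  -- the tail
  have htail : ∑ s ∈ Ico (2 * n + 1) (4 * n + 1), (s : ℝ) * g s ≤
      8 * ∑ k ∈ Icc 1 (2 * n), (k : ℝ) * g k := by
    have h1 : ∑ s ∈ Ico (2 * n + 1) (4 * n + 1), (s : ℝ) * g s ≤
        ∑ s ∈ Ico (2 * n + 1) (4 * n + 1), (4 * n : ℝ) * g (2 * n) := by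
      refine sum_le_sum fun s hs => ?_
      rw [mem_Ico] at hs
      have hs4 : (s : ℝ) ≤ 4 * n := by exact_mod_cast (show s ≤ 4 * n by omega)
      exact mul_le_mul hs4 (hanti (by omega)) (hg0 s) (by positivity)
    have h2 : ∑ s ∈ Ico (2 * n + 1) (4 * n + 1), (4 * n : ℝ) * g (2 * n) =
        8 * ((n : ℝ) * ((n : ℝ) * g (2 * n))) := by
      rw [sum_const, Nat.card_Ico, nsmul_eq_mul]
      have : ((4 * n + 1 - (2 * n + 1) : ℕ) : ℝ) = 2 * n := by
        rw [show 4 * n + 1 - (2 * n + 1) = 2 * n by omega]; push_cast; ring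
      rw [this]; ring
    have h3 : (n : ℝ) * ((n : ℝ) * g (2 * n)) ≤ ∑ k ∈ Icc 1 (2 * n), (k : ℝ) * g k := by
      calc (n : ℝ) * ((n : ℝ) * g (2 * n)) = ∑ k ∈ Icc (n + 1) (2 * n), (n : ℝ) * g (2 * n) := by
            rw [sum_const, Nat.card_Icc, nsmul_eq_mul]
            have : ((2 * n + 1 - (n + 1) : ℕ) : ℝ) = n := by
              rw [show 2 * n + 1 - (n + 1) = n by omega]
            rw [this]
        _ ≤ ∑ k ∈ Icc (n + 1) (2 * n), (k : ℝ) * g k := by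
            refine sum_le_sum fun k hk => ?_
            rw [mem_Icc] at hk
            have hkn : (n : ℝ) ≤ k := by exact_mod_cast (show n ≤ k by omega)
            exact mul_le_mul hkn (hanti hk.2) (hg0 _) (Nat.cast_nonneg k)
        _ ≤ ∑ k ∈ Icc 1 (2 * n), (k : ℝ) * g k :=
            sum_le_sum_of_subset_of_nonneg (Icc_subset_Icc (by omega) le_rfl)
              fun k _ _ => mul_nonneg (Nat.cast_nonneg k) (hg0 k)
    calc ∑ s ∈ Ico (2 * n + 1) (4 * n + 1), (s : ℝ) * g s
        ≤ 8 * ((n : ℝ) * ((n : ℝ) * g (2 * n))) := h1.trans_eq h2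
      _ ≤ 8 * ∑ k ∈ Icc 1 (2 * n), (k : ℝ) * g k := by gcongr
  rw [hsplit, hhead]
  linarith

/-! ### Two pieces of real arithmetic -/

/-- `1 + 18 W ≤ (g⁻¹ + 18) W` when `0 < g ≤ W` (absorbing an additive constant into the axis sum,
whose `k = 1` term is `g = ⟨σ₀σ_{e₁}⟩ > 0`). [folklore] -/
theorem one_add_mul_le_inv_add_mul {g W : ℝ} (hg : 0 < g) (hgW : g ≤ W) :
    1 + 18 * W ≤ (g⁻¹ + 18) * W := by
  have h1 : 1 ≤ g⁻¹ * W := by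
    rw [← div_eq_inv_mul, le_div_iff₀ hg, one_mul]
    exact hgW
  nlinarith

/-- The final step of the proof of Theorem 1.3: from `c₀ ≤ T₁ + T₂`, `T₁ ≤ 2Daχ`,
`T₂ ≤ 2Da(MP)` with `M, χ ≥ 1`, `a, P ≥ 0`, `D > 0`, conclude `c₀/(2DM) / (χ + P) ≤ a`. [folklore] -/
theorem div_div_le_of_halves {c₀ T₁ T₂ a χ P M D : ℝ} (hT : c₀ ≤ T₁ + T₂) (h1 : T₁ ≤ 2 * D * a * χ)
    (h2 : T₂ ≤ 2 * D * a * (M * P)) (hM : 1 ≤ M) (hχ : 1 ≤ χ) (ha : 0 ≤ a) (hD : 0 < D)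
    (hP : 0 ≤ P) : c₀ / (2 * D * M) / (χ + P) ≤ a := by
  have hM0 : 0 < M := one_pos.trans_le hM
  have hχ0 : 0 ≤ χ := zero_le_one.trans hχ
  have hDM : 0 < 2 * D * M := by positivity
  have hden : 0 < χ + P := by linarith
  have hprod : 0 ≤ (M - 1) * (2 * D * a * χ) := mul_nonneg (sub_nonneg.2 hM) (by positivity)
  have hkey : c₀ ≤ 2 * D * M * (a * (χ + P)) := by nlinarith
  rw [div_le_iff₀ hden, div_le_iff₀' hDM]
  exact hkey

/-! ### Theorem 1.3 from Theorem 1.2 -/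

/-- **Duminil-Copin–Panis 2025, Theorem 1.3 at `β_c` from Theorem 1.2 at `β_c`** (nearest-
neighbour Ising model on `ℤ^d`, `d ≥ 3`): the reflected-current inequality
`dcp_reflectedGradient_lower` implies the axial lower bound `dcp_criticalTwoPoint_axis_lower`,
`⟨σ₀σ_{ne₁}⟩_{β_c} ≥ c₁ / (χ_{4n}(β_c) + n^{d-2} ∑_{1≤k≤2n} k⟨σ₀σ_{ke₁}⟩_{β_c})` for `n ≥ N₁`.
Printed proof (p. 5): Theorem 1.2 at `4n`, the two halves `x₁ ≤ 2n` / `x₁ > 2n` bounded by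
Messager–Miracle-Solé and the gradient estimate (1.11)
(`DCPBubble.firstHalf_le`, `DCPBubble.secondHalf_le`, `twoPointFree_criticalBeta_gradient_estimate`).
[cite: DuminilCopinPanis2025LowerBounds, Theorem 1.3 (proof, eqs. (1.10)–(1.13)) with Theorem 1.2] -/
theorem dcp_criticalTwoPoint_axis_lower_of_reflectedGradient
    (h : dcp_reflectedGradient_lower (d := d)) : dcp_criticalTwoPoint_axis_lower (d := d) := by
  intro hd
  have hd1 : 0 < d := by omega
  have hβ : 0 ≤ criticalBeta d := criticalBeta_nonneg d
  set β : ℝ := criticalBeta d with hβdef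
  set G : Site d → ℝ := twoPointFree d β with hG
  set i : Fin d := ⟨0, hd1⟩ with hidef
  -- inputs: GKS, Messager–Miracle-Solé, evenness, the gradient estimate (1.11)
  have hG0 : ∀ x, 0 ≤ G x := fun x =>
    twoPointFree_nonneg hasBoxLimit_isingCorr_free_holds (GKSInequalities.gks_one_holds (zdGraph d)) hβ x
  have hG1 : ∀ x, G x ≤ 1 := fun x => twoPointFree_le_one hasBoxLimit_isingCorr_free_holds hβ x
  have hGev : ∀ x : Site d, G (-x) = G x := fun x => by
    simp only [hG]
    rw [← twoPointFree_abs_eq hβ (-x), ← twoPointFree_abs_eq hβ x]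
    simp [abs_neg]
  have hmono : ∀ x : Site d, 0 ≤ x i → G (x + Pi.single i 1) ≤ G x := fun x hx =>
    messager_miracleSole_free hβ x i hx
  have hgrad : ∀ (x : Site d) (j : ℕ), (j : ℤ) ≤ x i →
      G x - G (x + Pi.single i 1) ≤ G (Pi.single i (j : ℤ)) / ((x i : ℝ) - j + 1) :=
    fun x j hj => twoPointFree_criticalBeta_gradient_estimate hd i x j hj
  have hmonoAxis : ∀ k : ℕ, G (Pi.single i ((k + 1 : ℕ) : ℤ)) ≤ G (Pi.single i (k : ℤ)) := by
    intro k
    have hk := hmono (Pi.single i (k : ℤ)) (by simp)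
    rw [← Pi.single_add] at hk
    push_cast
    exact hk
  -- `g₁ = ⟨σ₀σ_{e₁}⟩_{β_c} > 0` (Simon's lower bound; plus state = free state at `β_c`)
  have hg1 : 0 < G (Pi.single i 1) := by
    obtain ⟨c, C, hc, hbd⟩ := criticalTwoPoint_bounds_holds (d := d) hd
    have hne : (Pi.single i 1 : Site d) ≠ 0 := by
      intro h0
      have h0i := congrFun h0 i
      simp at h0i
    have hlow := (hbd (Pi.single i 1) hne).1
    have hpos : 0 < c * (‖(Pi.single i 1 : Site d)‖ : ℝ) ^ (-((d : ℝ) - 1)) :=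
      mul_pos hc (Real.rpow_pos_of_pos (norm_pos_iff.2 hne) _)
    have heq : criticalTwoPoint d (Pi.single i 1) = G (Pi.single i 1) :=
      twoPointPlus_criticalBeta_eq_twoPointFree_holds hd _
    rw [heq] at hlow
    exact hpos.trans_le hlow
  -- Theorem 1.2 at `β_c`
  obtain ⟨c₀, hc₀, N₀, hN₀, hmain⟩ := h hd
  -- the constant `M = 2 · 9^{d-1} (g₁⁻¹ + 18) ≥ 1`
  obtain ⟨M, hMdef⟩ : ∃ M : ℝ, M = 2 * 9 ^ (d - 1) * ((G (Pi.single i 1))⁻¹ + 18) := ⟨_, rfl⟩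
  have hM1 : 1 ≤ M := by
    have h9 : (1 : ℝ) ≤ 9 ^ (d - 1) := one_le_pow₀ (by norm_num)
    have hinv : 0 ≤ (G (Pi.single i 1))⁻¹ := inv_nonneg.2 (hG0 _)
    rw [hMdef]; nlinarith
  have hM0 : 0 < M := one_pos.trans_le hM1
  have hdpos : (0 : ℝ) < d := by exact_mod_cast hd1
  refine ⟨c₀ / (2 * d * M), by positivity, max N₀ 1, lt_max_of_lt_right one_pos, fun n hn => ?_⟩
  have hnN : N₀ ≤ n := le_of_max_le_left hn
  have hn1 : 1 ≤ n := le_of_max_le_right hn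
  have hnpos : (0 : ℝ) < n := by exact_mod_cast hn1
  -- Theorem 1.2 at `m = 4n`, in the proof file's rendering
  have hT : c₀ ≤ ∑ x ∈ box d (4 * n), ∑ y ∈ (box d (4 * n)).filter (fun y => (zdGraph d).Adj x y),
      (G x - G (axisRefl i (2 * (4 * n : ℕ)) x)) * G (y - axisRefl i (2 * (4 * n : ℕ)) y) := by
    refine (hmain (4 * n) (by omega)).trans_eq ?_
    refine Finset.sum_congr rfl fun x _ => ?_
    rw [Finset.sum_filter]
    refine Finset.sum_congr rfl fun y _ => ?_
    split_ifs with hxy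
    · have hpair : freeExpect d (criticalBeta d) 0 (spinPair y (dcpReflect i ((4 * n : ℕ) : ℤ) y)) =
          G (y - dcpReflect i ((4 * n : ℕ) : ℤ) y) := by
        have h1 : freeExpect d β 0 (spinPair y (dcpReflect i ((4 * n : ℕ) : ℤ) y)) =
            twoPointFree d β (dcpReflect i ((4 * n : ℕ) : ℤ) y - y) :=
          freePair_eq_twoPointFree_sub hβ y _
        rw [h1, ← hGev]
        congr 1
        abel
      have hR : ∀ z : Site d, dcpReflect i ((4 * n : ℕ) : ℤ) z = axisRefl i (2 * (4 * n : ℕ)) z := by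
        intro z
        funext j
        rw [dcpReflect, Function.update_apply, axisRefl_apply]
      rw [hpair, hR, hR]
    · rfl
  -- split into the two halves
  rw [← sum_filter_add_sum_filter_not (box d (4 * n)) (fun x : Site d => 2 * x i ≤ ((4 * n : ℕ) : ℤ))]
    at hT
  have h1 := firstHalf_le (G := G) (i := i) hG0 hGev hmono (n := 4 * n) (by omega)
  have h2 := secondHalf_le (G := G) (i := i) hG0 hGev hmono hgrad (4 * n)
  have h3 := tsum_shift_le (G := G) (i := i) hG1 hG0 hmono (4 * n)
  -- first half: `G((4n-2)e₁) ≤ G(n e₁)`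
  have hA : G (Pi.single i (((4 * n : ℕ) : ℤ) - 2)) ≤ G (Pi.single i (n : ℤ)) :=
    axis_le_axis hmono (by positivity) (by push_cast; omega)
  have ha0 : 0 ≤ G (Pi.single i (n : ℤ)) := hG0 _
  have hχ0 : 0 ≤ ∑ x ∈ box d (4 * n), G x := sum_nonneg fun x _ => hG0 x
  have hχ1 : 1 ≤ ∑ x ∈ box d (4 * n), G x := by
    have h0 : (0 : Site d) ∈ box d (4 * n) := zero_mem_box d (4 * n)
    have hle := single_le_sum (f := G) (fun x _ => hG0 x) h0
    have hG00 : G 0 = 1 := twoPointFree_zero' β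
    rw [hG00] at hle
    exact hle
  have hfirst := h1.trans
    (mul_le_mul_of_nonneg_right (mul_le_mul_of_nonneg_left hA (by positivity)) hχ0)
  -- second half: `⌊4n/4⌋ = n`, the axis sum shortened to `k ≤ 2n`, the constant absorbed
  have hm4 : ((4 * n : ℕ) / 4 : ℕ) = n := by omega
  rw [hm4] at h2
  have hW0 : 0 ≤ ∑ k ∈ Icc 1 (2 * n), (k : ℝ) * G (Pi.single i (k : ℤ)) :=
    sum_nonneg fun k _ => mul_nonneg (Nat.cast_nonneg k) (hG0 _)
  have hWg : G (Pi.single i 1) ≤ ∑ k ∈ Icc 1 (2 * n), (k : ℝ) * G (Pi.single i (k : ℤ)) := by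
    have hmem : (1 : ℕ) ∈ Icc 1 (2 * n) := by rw [mem_Icc]; omega
    have hle := single_le_sum (f := fun k : ℕ => (k : ℝ) * G (Pi.single i (k : ℤ)))
      (fun k _ => mul_nonneg (Nat.cast_nonneg k) (hG0 _)) hmem
    simpa using hle
  have h9 := sum_range_mul_le_nine_mul_sum_Icc (g := fun k : ℕ => G (Pi.single i (k : ℤ)))
    (fun k => hG0 _) hmonoAxis n
  have hS : ∑ t ∈ range (4 * n + 1), (t : ℝ) * G (Pi.single i (2 * (t : ℤ) - 2)) ≤
      ((G (Pi.single i 1))⁻¹ + 18) * ∑ k ∈ Icc 1 (2 * n), (k : ℝ) * G (Pi.single i (k : ℤ)) := by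
    refine le_trans ?_ (one_add_mul_le_inv_add_mul hg1 hWg)
    linarith [h3, h9]
  have hpow : (2 * ((4 * n : ℕ) : ℝ) + 1) ^ (d - 1) * (8 / ((4 * n : ℕ) : ℝ)) ≤
      2 * 9 ^ (d - 1) * (n : ℝ) ^ (d - 2) := by
    obtain ⟨e, he⟩ : ∃ e, d - 1 = e + 1 := ⟨d - 2, by omega⟩
    have hde : d - 2 = e := by omega
    rw [he, hde]
    push_cast
    have hn1' : (1 : ℝ) ≤ n := by exact_mod_cast hn1
    have hle : (2 * (4 * (n : ℝ)) + 1) ≤ 9 * n := by linarith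
    have hb : (2 * (4 * (n : ℝ)) + 1) ^ (e + 1) ≤ (9 * n) ^ (e + 1) :=
      pow_le_pow_left₀ (by positivity) hle _
    calc (2 * (4 * (n : ℝ)) + 1) ^ (e + 1) * (8 / (4 * (n : ℝ)))
        ≤ (9 * n) ^ (e + 1) * (8 / (4 * (n : ℝ))) := by gcongr
      _ = 2 * 9 ^ (e + 1) * (n : ℝ) ^ e := by
          field_simp
          ring
  have hP0 : 0 ≤ (n : ℝ) ^ (d - 2) * ∑ k ∈ Icc 1 (2 * n), (k : ℝ) * G (Pi.single i (k : ℤ)) :=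
    mul_nonneg (by positivity) hW0
  have hsecond : ∑ x ∈ (box d (4 * n)).filter (fun x : Site d => ¬ 2 * x i ≤ ((4 * n : ℕ) : ℤ)),
      ∑ y ∈ (box d (4 * n)).filter (fun y => (zdGraph d).Adj x y),
        (G x - G (axisRefl i (2 * (4 * n : ℕ)) x)) * G (y - axisRefl i (2 * (4 * n : ℕ)) y) ≤
      2 * d * G (Pi.single i (n : ℤ)) *
        (M * ((n : ℝ) ^ (d - 2) * ∑ k ∈ Icc 1 (2 * n), (k : ℝ) * G (Pi.single i (k : ℤ)))) := by
    refine h2.trans ?_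
    have hS0 : 0 ≤ ∑ t ∈ range (4 * n + 1), (t : ℝ) * G (Pi.single i (2 * (t : ℤ) - 2)) :=
      sum_nonneg fun t _ => mul_nonneg (Nat.cast_nonneg t) (hG0 _)
    have hF0 : 0 ≤ (2 * ((4 * n : ℕ) : ℝ) + 1) ^ (d - 1) * (8 / ((4 * n : ℕ) : ℝ)) := by positivity
    calc 2 * d * (2 * ((4 * n : ℕ) : ℝ) + 1) ^ (d - 1) * (8 / ((4 * n : ℕ) : ℝ) * G (Pi.single i (n : ℤ))) *
          ∑ t ∈ range (4 * n + 1), (t : ℝ) * G (Pi.single i (2 * (t : ℤ) - 2))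
        = 2 * d * G (Pi.single i (n : ℤ)) *
            (((2 * ((4 * n : ℕ) : ℝ) + 1) ^ (d - 1) * (8 / ((4 * n : ℕ) : ℝ))) *
              ∑ t ∈ range (4 * n + 1), (t : ℝ) * G (Pi.single i (2 * (t : ℤ) - 2))) := by ring
      _ ≤ 2 * d * G (Pi.single i (n : ℤ)) *
            ((2 * 9 ^ (d - 1) * (n : ℝ) ^ (d - 2)) *
              (((G (Pi.single i 1))⁻¹ + 18) * ∑ k ∈ Icc 1 (2 * n), (k : ℝ) * G (Pi.single i (k : ℤ)))) := by
          refine mul_le_mul_of_nonneg_left ?_ (by positivity)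
          exact mul_le_mul hpow hS hS0 (by positivity)
      _ = 2 * d * G (Pi.single i (n : ℤ)) *
            (M * ((n : ℝ) ^ (d - 2) * ∑ k ∈ Icc 1 (2 * n), (k : ℝ) * G (Pi.single i (k : ℤ)))) := by
          rw [hMdef]; ring
  -- assemble
  exact div_div_le_of_halves hT hfirst hsecond hM1 hχ1 ha0 hdpos hP0

end Literature.Probability.LatticeModels

end
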